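import Mathlib
import HarnessLib
import Literature.Analysis.FluidPDE.SuitableWeak
import Literature.Analysis.FluidPDE.SelfSimilar
import Literature.Analysis.FluidPDE.LocalTypeI
import Summits.NavierStokesRegularity.NavierStokesRegularity.Theorems.RellichScarApexLocalisationQuantumCovariance
import Summits.NavierStokesRegularity.NavierStokesRegularity.Theorems.RellichScarApexLocalisationQuantumAccountingSharp
import Summits.NavierStokesRegularity.NavierStokesRegularity.Theorems.RellichScarApexLocalisationTightIsApexKappa
import Summits.NavierStokesRegularity.NavierStokesRegularity.Theorems.RellichScarApexLocalisationQuantumReduction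
import Summits.NavierStokesRegularity.NavierStokesRegularity.Theses.RellichScar

/-!
# Line `dissipation-quantum-tolerance`, v2: the reduction certificates (crux `RellichScar.ApexLocalisation`,
# stmt-NavierStokesRegularity-11719; lead prover-line-stmt-NavierStokesRegularity-11719-c4-0, closing lead c3's v2)

This file lands the three registered composition certificates of the line that were still open after
lead c3's session, so that the line's record is complete:

* `apexLocalisation_of_tightProfileExistsV2` — **the v2 bet implies the crux**: the bet selects a class
  `(C₁, I₁)`, a unit-band dissipation quantum `e` of `(C₁, 4I₁)` and a dissipation-tight origin-singular
  profile (`sup_r E(Q((0,0),r)) < (3 + 5√2/2) e`); covariance (`stub_quantumCovariance`, p118116) spreads the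
  quantum to every singular final-slice point at every scale; tightness with the sharp one-companion price
  (`stub_tightIsApexKappa`, p119914, fed `stub_quantumAccountingSharp.2`, p119404) makes the profile apex;
  its own `𝐈 ≤ I₁ < ⊤` and singular origin give the crux conclusion.  This is exactly the composition
  `ApexLocalisation_of` of the registered skeleton v2.1 (`Cruxes/ApexLocalisation/Lines/dissipation_quantum_tolerance.lean`)
  with its one remaining `sorry` (the bet `stub_tightProfileExistsV2`) turned into the hypothesis.
* `apexLocalisation_of_tightProfileExists` — the v1 bet (∀e-form, threshold `9/4`) implies the crux, but
  VACUOUSLY: by `tightProfileExistsV1_iff` (p119999) the v1 bet says that no rate-Type-I singular slab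
  profile exists at all, so the crux antecedent is empty.
* `dissipationFloor` — the coarse floor `E(Q((0,0),R)) ≥ 2 e(C,I)` at every scale, a corollary of the sharp
  floor `(2+2√2) e(C,I)` (`dissipationFloorSharp`, p119999).

Status of the line after this file: every registered stub except the bet `stub_tightProfileExistsV2` is
landed; the bet is a SUFFICIENT condition for the crux (not an equivalent form), (L)-vacuous, with no
mechanism producing dissipation-tight profiles (analysis: `Cruxes/ApexLocalisation/Lines/dissipation-quantum-tolerance-lead-c3.md`).

References: D. Albritton, T. Barker, J. Math. Fluid Mech. 21 (2019) = arXiv:1811.00502 [AlbrittonBarker2019];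
L. Caffarelli, R. Kohn, L. Nirenberg, Comm. Pure Appl. Math. 35 (1982) [CaffarelliKohnNirenberg1982].
-/

-- the summit and its single sub-problem share the name (CONVENTIONS §1), as in every Theorems file
set_option linter.dupNamespace false

namespace Summit.NavierStokesRegularity.NavierStokesRegularity.Theorems.RellichScarApexLocalisation

open MeasureTheory Set Function Metric Filter Topology TopologicalSpace
open scoped ENNReal NNReal
open Literature.Analysis Literature.Analysis.FluidPDE

local notation "E³" => EuclideanSpace ℝ (Fin 3)

/-! ### The v2 bet implies the crux -/

/-- **The v2 bet implies the crux** (registered certificate of the line `dissipation-quantum-tolerance`):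
if, whenever a rate-Type-I singular slab profile exists, some continuous class `(C₁, I₁)` (`I₁ < ⊤`)
carries a unit-band dissipation quantum `e > 0` of the class `(C₁, 4I₁)` together with an origin-singular
class-`(C₁, I₁)` profile whose total scaled dissipation about the origin is below the one-companion price
`(3 + 5√2/2) e`, then `RellichScar.ApexLocalisation` holds: the quantum spreads to every singular
final-slice point at every scale (`stub_quantumCovariance`), a tight profile is apex
(`stub_tightIsApexKappa` with `κ = 3 + 5√2/2`, fed the sharp accounting `stub_quantumAccountingSharp.2`),
and the profile's own `𝐈 ≤ I₁ < ⊤` and singular origin complete the conclusion. -/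
theorem apexLocalisation_of_tightProfileExistsV2
    (hbet : ∀ C : ℝ, (∃ (u : ℝ → E³ → E³) (p : ℝ → E³ → ℝ) (G : ℝ → E³ → E³ →L[ℝ] E³),
        IsSuitableWeakSolutionOn (slab E³ (Iio 0) isOpen_Iio) 1 0 u p ∧
        HasWeakSpatialGradientOn (slab E³ (Iio 0) isOpen_Iio) u G ∧
        typeIBound (Set.Iio (0 : ℝ) ×ˢ Set.univ) u p G < ⊤ ∧ HasTypeITimeDecay C u ∧
        IsBackwardSingularPoint u 0) →
      ∃ (C₁ : ℝ) (I₁ : ℝ≥0∞) (e : ℝ), I₁ < ⊤ ∧ 0 < e ∧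
        (∀ (v : ℝ → E³ → E³) (q : ℝ → E³ → ℝ) (H : ℝ → E³ → E³ →L[ℝ] E³),
          IsSuitableWeakSolutionOn (slab E³ (Iio 0) isOpen_Iio) 1 0 v q →
          HasWeakSpatialGradientOn (slab E³ (Iio 0) isOpen_Iio) v H →
          typeIBound (Iio (0 : ℝ) ×ˢ univ) v q H ≤ 4 * I₁ →
          HasTypeITimeDecay C₁ v →
          ContinuousOn (uncurry v) (Iio (0 : ℝ) ×ˢ univ) →
          IsBackwardSingularPoint v 0 →
          ENNReal.ofReal e ≤ ∫⁻ z in parabolicCylinder (1 / 2 : ℝ) ((-(1 / 4) : ℝ), (0 : E³)),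
            ENNReal.ofReal (frobeniusNormSq (H z.1 z.2))) ∧
        ∃ (u : ℝ → E³ → E³) (p : ℝ → E³ → ℝ) (G : ℝ → E³ → E³ →L[ℝ] E³),
          IsSuitableWeakSolutionOn (slab E³ (Iio 0) isOpen_Iio) 1 0 u p ∧
          HasWeakSpatialGradientOn (slab E³ (Iio 0) isOpen_Iio) u G ∧
          typeIBound (Iio (0 : ℝ) ×ˢ univ) u p G ≤ I₁ ∧
          HasTypeITimeDecay C₁ u ∧
          ContinuousOn (uncurry u) (Iio (0 : ℝ) ×ˢ univ) ∧
          IsBackwardSingularPoint u 0 ∧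
          (⨆ (r : ℝ) (_ : 0 < r), cknE r ((0 : ℝ), (0 : E³)) G) <
            ENNReal.ofReal ((3 + 5 / 2 * Real.sqrt 2) * e)) :
    Summit.NavierStokesRegularity.NavierStokesRegularity.Theses.RellichScar.ApexLocalisation := by
  intro C hant
  obtain ⟨C₁, I₁, e, hI₁, he, hq, u, p, G, hsw, hwg, hIle, hC, hcont, hsing, htight⟩ := hbet C hant
  have hgen := stub_quantumCovariance C₁ (4 * I₁) e he.le hq
  obtain ⟨C', hapex⟩ := stub_tightIsApexKappa (3 + 5 / 2 * Real.sqrt 2) stub_quantumAccountingSharp.2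
    C₁ I₁ e hI₁ he hgen u p G hsw hwg hIle hC hcont hsing htight
  exact ⟨C', u, p, G, hsw, hwg, lt_of_le_of_lt hIle hI₁, hapex, hsing⟩

/-! ### The v1 bet implies the crux (vacuously) -/

/-- **The v1 bet implies the crux — vacuously** (registered certificate): the ∀e-form tolerance bet
with threshold `9/4` is, by `tightProfileExistsV1_iff`, the statement that NO rate-Type-I singular slab
profile exists for any rate constant, so under it the crux antecedent is empty and the crux holds.
(Recorded to close the line's v1 books; the v1 regime is empty because the quantum floor alone is
`(2+2√2) e > (9/4) e`.) -/
theorem apexLocalisation_of_tightProfileExists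
    (hbet : ∀ C : ℝ, (∃ (u : ℝ → E³ → E³) (p : ℝ → E³ → ℝ) (G : ℝ → E³ → E³ →L[ℝ] E³),
        IsSuitableWeakSolutionOn (slab E³ (Iio 0) isOpen_Iio) 1 0 u p ∧
        HasWeakSpatialGradientOn (slab E³ (Iio 0) isOpen_Iio) u G ∧
        typeIBound (Set.Iio (0 : ℝ) ×ˢ Set.univ) u p G < ⊤ ∧ HasTypeITimeDecay C u ∧
        IsBackwardSingularPoint u 0) →
      ∃ (C₁ : ℝ) (I₁ : ℝ≥0∞), I₁ < ⊤ ∧ ∀ e : ℝ, 0 < e →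
        (∀ (v : ℝ → E³ → E³) (q : ℝ → E³ → ℝ) (H : ℝ → E³ → E³ →L[ℝ] E³),
          IsSuitableWeakSolutionOn (slab E³ (Iio 0) isOpen_Iio) 1 0 v q →
          HasWeakSpatialGradientOn (slab E³ (Iio 0) isOpen_Iio) v H →
          typeIBound (Iio (0 : ℝ) ×ˢ univ) v q H ≤ 4 * I₁ →
          HasTypeITimeDecay C₁ v →
          ContinuousOn (uncurry v) (Iio (0 : ℝ) ×ˢ univ) →
          IsBackwardSingularPoint v 0 →
          ENNReal.ofReal e ≤ ∫⁻ z in parabolicCylinder (1 / 2 : ℝ) ((-(1 / 4) : ℝ), (0 : E³)),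
            ENNReal.ofReal (frobeniusNormSq (H z.1 z.2))) →
        ∃ (u : ℝ → E³ → E³) (p : ℝ → E³ → ℝ) (G : ℝ → E³ → E³ →L[ℝ] E³),
          IsSuitableWeakSolutionOn (slab E³ (Iio 0) isOpen_Iio) 1 0 u p ∧
          HasWeakSpatialGradientOn (slab E³ (Iio 0) isOpen_Iio) u G ∧
          typeIBound (Iio (0 : ℝ) ×ˢ univ) u p G ≤ I₁ ∧
          HasTypeITimeDecay C₁ u ∧
          ContinuousOn (uncurry u) (Iio (0 : ℝ) ×ˢ univ) ∧
          IsBackwardSingularPoint u 0 ∧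
          (⨆ (r : ℝ) (_ : 0 < r), cknE r ((0 : ℝ), (0 : E³)) G) < ENNReal.ofReal (9 / 4 * e)) :
    Summit.NavierStokesRegularity.NavierStokesRegularity.Theses.RellichScar.ApexLocalisation := by
  intro C hant
  exact absurd hant (tightProfileExistsV1_iff.1 hbet C)

/-! ### The coarse dissipation floor -/

/-- **DISSIPATION FLOOR, coarse form** (registered corollary; unconditional): for every class `(C, I)`,
`I < ⊤`, there is `e > 0` such that every continuous class profile singular at the origin has
origin-anchored scaled dissipation `E(Q((0,0),R)) ≥ 2 e` at EVERY scale `R > 0` — the dyadic-grid count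
of the card; a corollary of the sharp `√2`-grid floor `(2+2√2) e` (`dissipationFloorSharp`). -/
theorem dissipationFloor :
    ∀ (C : ℝ) (I : ℝ≥0∞), I < ⊤ → ∃ e : ℝ, 0 < e ∧
      ∀ (u : ℝ → E³ → E³) (p : ℝ → E³ → ℝ) (G : ℝ → E³ → E³ →L[ℝ] E³),
        IsSuitableWeakSolutionOn (slab E³ (Iio 0) isOpen_Iio) 1 0 u p →
        HasWeakSpatialGradientOn (slab E³ (Iio 0) isOpen_Iio) u G →
        typeIBound (Iio (0 : ℝ) ×ˢ univ) u p G ≤ I →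
        HasTypeITimeDecay C u →
        ContinuousOn (uncurry u) (Iio (0 : ℝ) ×ˢ univ) →
        IsBackwardSingularPoint u 0 →
        ∀ R : ℝ, 0 < R → ENNReal.ofReal (2 * e) ≤ cknE R ((0 : ℝ), (0 : E³)) G := by
  intro C I hI
  obtain ⟨e, he, hfloor⟩ := dissipationFloorSharp C I hI
  refine ⟨e, he, fun u p G hsw hwg hIle hC hcont hsing R hR => ?_⟩
  refine le_trans (ENNReal.ofReal_le_ofReal ?_) (hfloor u p G hsw hwg hIle hC hcont hsing R hR)
  have h2 : (0 : ℝ) ≤ Real.sqrt 2 := Real.sqrt_nonneg 2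
  nlinarith

end Summit.NavierStokesRegularity.NavierStokesRegularity.Theorems.RellichScarApexLocalisation
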